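import Summits.CriticalPhenomena.PercolationContinuityZ3.Theorems.PercNearOneGluingNoHeavySamePContinuation
import HarnessLib

/-!
# The PEIERLS HALF of Theorem A without the envelope bound: a lawful scheme at `p` forces `θ(p) > 0` (design (D) 'CONCENTRIC', HOME/ENTRY-SEED-STAR.md §10)

builds on p205010 (kernel theorem, internal audit signed; external expert review pending) — nothing in this file uses p205010.
Lane `prim-bschramm`, lead seat (gen 2); helper file (`--supports stmt-CriticalPhenomena-4575`).

p4's continuation principle `SameP.criticalProb_lt_of_lawful` (p207164) needs a UNIFORM bound `N` on the probes' envelopes only for the perturbation step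
`lawful_of_near` (`p ↦ q`).  Kozma–Nitzan's own endgame re-runs the construction at the smaller density instead; for that only the Peierls half is
needed, which has no envelope hypothesis:
* **`theta_pos_of_lawful`** — `Lawful G p ε`, `ε ≤ 2⁻³²`, `U₀ ⊆ E(G)`, `0 < p`, and "infinite macro-cluster ⇒ `x₀ ↔ ∞` (up to `ω ⊄ E(G)`)" give `0 < θ_{x₀}(p)`
  (`θ ≥ P(initEvent)/3 > 0`);  `criticalProb_le_of_lawful` — hence `p_c(G, x₀) ≤ p`;
* **`theta_criticalProb_eq_zero_of_drop`** — the DROP form of the closing argument: if every density `p` with `θ_{x₀}(p) > 0` admits `q < p` with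
  `θ_{x₀}(q) > 0`, then `θ_{x₀}(p_c) = 0` (no scheme, no envelope: pure order theory on `p_c = inf`).
[cite: KozmaNitzan2024, §1 p. 2 (approach 1), §4 p. 31 (the continuity step)] [cite: GrimmettPercolation1999, §1.4]
-/

noncomputable section

open MeasureTheory ProbabilityTheory

namespace Summit.CriticalPhenomena.PercolationContinuityZ3.Theorems

namespace SameP

open Literature.Probability.Percolation Literature.Probability.LatticeModels SimpleGraph

variable {V : Type}

/-- **Peierls half of the continuation principle (no envelope bound).** A scheme lawful AT `p` with `ε ≤ 2⁻³²`, initial edges in `E(G)`, `p > 0`,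
and whose infinite macro-cluster forces `x₀ ↔ ∞`, gives `θ_{x₀}(p) > 0`. [cite: KozmaNitzan2024, §1 p. 2 (approach 1)] -/
theorem theta_pos_of_lawful [Countable V] {S : HSiteScheme V} {G : SimpleGraph V} {p : unitInterval} {ε : ℝ}
    (hL : S.Lawful G p ε) (hε : ε ≤ (1 / 2) ^ 32) (hU : (↑S.U₀ : Set (Sym2 V)) ⊆ G.edgeSet) (hp : 0 < (p : ℝ)) {x₀ : V}
    (hperc : S.initEvent ∩ {ω | (S.occFinal ω).Infinite} ⊆ percolatesAt x₀ ∪ {ω | ¬ω ⊆ G.edgeSet}) :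
    0 < theta G x₀ p := by
  have h3 := HSiteScheme.measureReal_le_three_mul_of_subset hL hε hperc
  have hA0 := HSiteScheme.initEvent_pos (S := S) (G := G) (p := p) hU hp
  have hN0 : (bondPercolation G p).real {ω | ¬ω ⊆ G.edgeSet} = 0 := by
    rw [measureReal_def, ENNReal.toReal_eq_zero_iff]
    left
    rw [measure_eq_zero_iff_ae_notMem]
    filter_upwards [(ProbabilityTheory.setBernoulli_ae_subset :
      ∀ᵐ ω ∂(bondPercolation G p), ω ⊆ G.edgeSet)] with ω hω using fun h => h hω
  have hUn := measureReal_union_le (μ := bondPercolation G p) (percolatesAt x₀) {ω | ¬ω ⊆ G.edgeSet}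
  rw [hN0, add_zero] at hUn
  unfold theta
  nlinarith [hA0, h3, hUn]

/-- Hence `p_c(G, x₀) ≤ p` for such a scheme at `p`. [cite: KozmaNitzan2024, §1 p. 2] -/
theorem criticalProb_le_of_lawful [Countable V] {S : HSiteScheme V} {G : SimpleGraph V} {p : unitInterval} {ε : ℝ}
    (hL : S.Lawful G p ε) (hε : ε ≤ (1 / 2) ^ 32) (hU : (↑S.U₀ : Set (Sym2 V)) ⊆ G.edgeSet) (hp : 0 < (p : ℝ)) {x₀ : V}
    (hperc : S.initEvent ∩ {ω | (S.occFinal ω).Infinite} ⊆ percolatesAt x₀ ∪ {ω | ¬ω ⊆ G.edgeSet}) :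
    criticalProb G x₀ ≤ p :=
  OrbitQuotient.criticalProb_le_of_theta_pos G x₀ p (theta_pos_of_lawful hL hε hU hp hperc)


/-- **The DROP form of the closing argument.** If at every density with `θ_{x₀} > 0` there is a strictly smaller density with `θ_{x₀} > 0`, then
`θ_{x₀}(p_c) = 0`. [cite: KozmaNitzan2024, §1 p. 2 (approach 1)] -/
theorem theta_criticalProb_eq_zero_of_drop (G : SimpleGraph V) (x₀ : V)
    (h : ∀ p : unitInterval, 0 < theta G x₀ p → ∃ q : unitInterval, (q : ℝ) < p ∧ 0 < theta G x₀ q) :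
    theta G x₀ ⟨criticalProb G x₀, criticalProb_mem_Icc G x₀⟩ = 0 := by
  by_contra hne
  have hpos : 0 < theta G x₀ ⟨criticalProb G x₀, criticalProb_mem_Icc G x₀⟩ :=
    lt_of_le_of_ne measureReal_nonneg (Ne.symm hne)
  obtain ⟨q, hq, hθq⟩ := h _ hpos
  have hle := OrbitQuotient.criticalProb_le_of_theta_pos G x₀ q hθq
  exact absurd hq (not_lt.2 hle)

end SameP

end Summit.CriticalPhenomena.PercolationContinuityZ3.Theorems

end
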